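import Summits.RiemannHypothesis.RiemannHypothesis.Theorems.JensenPolynomialsCapCertRecursion

/-!
# Route `JensenPolynomials` — `XiCumulantMajorantCap` kernel packaging, part 4: the scaled cumulant table

RH-FREE, γ-FREE proof-of-data for the numeric route child `XiCumulantMajorantCap` (stmt-RiemannHypothesis-19217) of
route `JensenPolynomials` (rung J-P(P1′), cell rh-jensen, engine target ET1 «C2GEN-CERT»). Nothing here bears on the truth of RH.
The recursion `ẽ_{j+1} = (Σ_{2≤i≤j} b̃_{i+1}ẽ_{j−i})/(j+1)` of `ẽ_j = e_j λ^j`, the uniform bound `ẽ_j ≤ 1` (from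
`B_K⁺ + T_K⁺ ≤ 3·ONE`), the table domination `ẽ_j ≤ ẽ⁺_j/ONE`, and the uniform tail bound `ẽ_i ≤ η/ONE` (`i > JJ − KK`).
-/

-- D-0017: `Summit.RiemannHypothesis.RiemannHypothesis.…` duplicates the namespace BY DESIGN (single-problem summit).
set_option linter.dupNamespace false

namespace Summit.RiemannHypothesis.RiemannHypothesis.Theorems.JensenPolynomials.CapCert

open Finset Real
open Summit.RiemannHypothesis.RiemannHypothesis.Theorems.JensenPolynomials
open Finset Real
open Summit.RiemannHypothesis.RiemannHypothesis.Theorems.JensenPolynomials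

/-- Numeric values of the truncation parameters: `KK = 30`, `JJ = 150`. -/
theorem KKJJ_val : KK = 30 ∧ JJ = 150 := ⟨rfl, rfl⟩

/-- **The scaled recursion `ẽ_{j+1} = (Σ_{2≤i≤j} b̃_{i+1} ẽ_{j−i})/(j+1)`.** -/
theorem et_succ (d j : ℕ) : et d (j + 1) =
    (∑ i ∈ range (j + 1), (if 2 ≤ i then bt d (i + 1) * et d (j - i) else 0)) / ((j : ℝ) + 1) := by
  unfold et
  rw [cumulantCoeff_succ, Fin.sum_univ_eq_sum_range
    (fun i => if 2 ≤ i then capFun d (i + 1) / (Nat.factorial i : ℝ) * cumulantCoeff (capFun d) (j - i) else 0) (j + 1)]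
  rw [div_mul_eq_mul_div, Finset.sum_mul]
  congr 1
  apply Finset.sum_congr rfl
  intro i hi
  rw [Finset.mem_range] at hi
  split_ifs with h2
  · unfold bt
    have hl : lam d ^ (j + 1) = lam d ^ (i + 1) * lam d ^ (j - i) := by
      rw [← pow_add]; congr 1; omega
    rw [hl, Nat.add_sub_cancel]
    ring
  · simp

/-- The recursion sum vanishes for `j + 1 < 3`. -/
theorem et_succ_small (d j : ℕ) (hj : j + 1 < 3) : et d (j + 1) = 0 := by
  rw [et_succ, Finset.sum_eq_zero (fun i hi => by rw [Finset.mem_range] at hi; rw [if_neg (by omega)]), zero_div]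

/-- All partial sums of the `b̃` are `≤ 3` when `B_K⁺ + T_K⁺ ≤ 3·ONE`. -/
theorem sumB_le_three (d : ℕ) (hyp : ypOf (xU d) < ONE)
    (hB : BKof (btListx d (xU d)) + Tof d (xU d) ≤ 3 * ONE) (n : ℕ) :
    ∑ i ∈ range n, (if 2 ≤ i then bt d (i + 1) else 0) ≤ 3 := by
  have hsplit : ∀ i ∈ range n, (if 2 ≤ i then bt d (i + 1) else 0)
      = (if 2 ≤ i ∧ i < KK then bt d (i + 1) else 0) + (if KK ≤ i then bt d (i + 1) else 0) := by
    intro i _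
    by_cases h2 : 2 ≤ i
    · by_cases hK : i < KK
      · have hnK : ¬ KK ≤ i := by omega
        rw [if_pos h2, if_pos ⟨h2, hK⟩, if_neg hnK, add_zero]
      · have hKle : KK ≤ i := by omega
        have hn : ¬ (2 ≤ i ∧ i < KK) := fun h => hK h.2
        rw [if_pos h2, if_neg hn, if_pos hKle, zero_add]
    · have hn : ¬ (2 ≤ i ∧ i < KK) := fun h => h2 h.1
      have hnK : ¬ KK ≤ i := by unfold KK; omega
      rw [if_neg h2, if_neg hn, if_neg hnK, add_zero]
  rw [Finset.sum_congr rfl hsplit, Finset.sum_add_distrib]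
  have h1 := sumBK_le d n
  have h2 := sumTail_le d n hyp
  have h3 : ((BKof (btListx d (xU d)) : ℝ) + (Tof d (xU d) : ℝ)) / ONE ≤ 3 := by
    rw [div_le_iff₀ ONE_facts.1]; exact_mod_cast hB
  rw [add_div] at h3
  linarith

/-- **`ẽ_j ≤ 1` for every `j`.** -/
theorem et_le_one (d : ℕ) (hB3 : ∀ n, ∑ i ∈ range n, (if 2 ≤ i then bt d (i + 1) else 0) ≤ 3) :
    ∀ j, et d j ≤ 1 := by
  intro j
  induction j using Nat.strong_induction_on with
  | _ j ih =>
    cases j with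
    | zero => rw [(cap_facts d).2.2.2.2]
    | succ j =>
      by_cases hj : j + 1 < 3
      · rw [et_succ_small d j hj]; exact zero_le_one
      · rw [et_succ]
        have hpos : (0 : ℝ) < (j : ℝ) + 1 := by positivity
        rw [div_le_one hpos]
        have hle : ∑ i ∈ range (j + 1), (if 2 ≤ i then bt d (i + 1) * et d (j - i) else 0)
            ≤ ∑ i ∈ range (j + 1), (if 2 ≤ i then bt d (i + 1) else 0) := by
          apply Finset.sum_le_sum
          intro i hi
          rw [Finset.mem_range] at hi
          split_ifs with h
          · have := ih (j - i) (by omega)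
            have hb := (bt_nonneg d (i + 1)).1
            nlinarith
          · exact le_rfl
        have h3 : (3 : ℝ) ≤ (j : ℝ) + 1 := by
          have : (3 : ℕ) ≤ j + 1 := by omega
          exact_mod_cast this
        linarith [hB3 (j + 1)]

/-- **`ẽ_j ≤ ẽ⁺_j/ONE` for every `j` (the checker's table dominates the true scaled coefficients).** -/
theorem et_le_etU (d : ℕ) (hyp : ypOf (xU d) < ONE)
    (hB : BKof (btListx d (xU d)) + Tof d (xU d) ≤ 3 * ONE) :
    ∀ j, et d j ≤ (etU (btListx d (xU d)) (Tof d (xU d)) j : ℝ) / ONE := by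
  -- concrete facts, then make the computational atoms opaque
  have hle1 := et_le_one d (sumB_le_three d hyp hB)
  have htail : ∀ n, ∑ i ∈ range n, (if KK ≤ i then bt d (i + 1) else 0) ≤ (Tof d (xU d) : ℝ) / ONE :=
    fun n => sumTail_le d n hyp
  have hget : ∀ i, 2 ≤ i → i < KK → (btListx d (xU d)).getD (i - 2) 0 = btUx d (xU d) (i + 1) :=
    fun i h2 hK => btListx_getD h2 hK
  have hbt : ∀ k, 3 ≤ k → bt d k ≤ (btUx d (xU d) k : ℝ) / ONE := fun k hk => bt_le_btUx d hk
  clear hB hyp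
  generalize btListx d (xU d) = bts at *
  generalize Tof d (xU d) = T at *
  generalize xU d = x at *
  intro j
  induction j using Nat.strong_induction_on with
  | _ j ih =>
    cases j with
    | zero => rw [(cap_facts d).2.2.2.2, etU_zero, div_self ONE_facts.2.1]
    | succ j =>
      rw [etU_succ]
      by_cases hj : j + 1 < 3
      · rw [if_pos hj, et_succ_small d j hj]; simp
      · rw [if_neg hj, et_succ]
        unfold etStep
        have hpos : (0 : ℝ) < (j : ℝ) + 1 := by positivity
        set F : ℕ → ℕ := fun i => if 2 ≤ i ∧ i < KK then bts.getD (i - 2) 0 * (etTab bts T j).getD i 0 else 0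
          with hF
        have hterm : ∀ i ∈ range (j + 1), (if 2 ≤ i then bt d (i + 1) * et d (j - i) else 0)
            ≤ ((F i : ℕ) : ℝ) / ONE / ONE + (if KK ≤ i then bt d (i + 1) else 0) := by
          intro i hi
          rw [Finset.mem_range] at hi
          by_cases h2 : 2 ≤ i
          · rw [if_pos h2]
            by_cases hK : i < KK
            · have hnK : ¬ KK ≤ i := by omega
              rw [if_neg hnK, add_zero, hF]
              simp only
              rw [if_pos ⟨h2, hK⟩, hget i h2 hK, etTab_getD bts T j i (by omega)]
              push_cast
              have hb := hbt (i + 1) (by omega)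
              have he := ih (j - i) (by omega)
              calc bt d (i + 1) * et d (j - i)
                  ≤ (btUx d x (i + 1) : ℝ) / ONE * ((etU bts T (j - i) : ℝ) / ONE) :=
                    mul_le_mul hb he ((et_nonneg d _).1) (((bt_nonneg d _).1).trans hb)
                _ = _ := by ring
            · have hKle : KK ≤ i := by omega
              have hn : ¬ (2 ≤ i ∧ i < KK) := fun h => hK h.2
              rw [if_pos hKle, hF]
              simp only
              rw [if_neg hn]
              push_cast
              rw [zero_div, zero_div, zero_add]
              have := hle1 (j - i)
              have hb := (bt_nonneg d (i + 1)).1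
              calc bt d (i + 1) * et d (j - i) ≤ bt d (i + 1) * 1 := mul_le_mul_of_nonneg_left this hb
                _ = bt d (i + 1) := mul_one _
          · have hn : ¬ (2 ≤ i ∧ i < KK) := fun h => h2 h.1
            have hnK : ¬ KK ≤ i := by unfold KK; omega
            rw [if_neg h2, hF]
            simp only
            rw [if_neg hn, if_neg hnK]
            simp
        have hsum := Finset.sum_le_sum hterm
        rw [Finset.sum_add_distrib, ← Finset.sum_div, ← Finset.sum_div, ← Nat.cast_sum] at hsum
        -- the tail part
        have htail' : ∑ i ∈ range (j + 1), (if KK ≤ i then bt d (i + 1) else 0)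
            ≤ ((if KK < j + 1 then T * ONE else 0 : ℕ) : ℝ) / ONE / ONE := by
          by_cases hKj : KK < j + 1
          · rw [if_pos hKj]; push_cast; rw [mul_div_assoc, div_self ONE_facts.2.1, mul_one]
            exact htail (j + 1)
          · rw [if_neg hKj, Finset.sum_eq_zero (fun i hi => by
                rw [Finset.mem_range] at hi
                have hnK : ¬ KK ≤ i := by omega
                rw [if_neg hnK])]
            simp
        set N : ℕ := (∑ i ∈ range (j + 1), F i) + (if KK < j + 1 then T * ONE else 0) with hN
        have key : (∑ i ∈ range (j + 1), (if 2 ≤ i then bt d (i + 1) * et d (j - i) else 0))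
            ≤ (N : ℝ) / ONE / ONE := by
          rw [hN]; push_cast; rw [add_div, add_div]
          refine hsum.trans ?_
          push_cast at htail' ⊢
          linarith
        have hden : 0 < (j + 1) * ONE := Nat.mul_pos (Nat.succ_pos j) ONE_facts.2.2
        have hc := div_le_cdiv N ((j + 1) * ONE) hden
        calc (∑ i ∈ range (j + 1), (if 2 ≤ i then bt d (i + 1) * et d (j - i) else 0)) / ((j : ℝ) + 1)
            ≤ ((N : ℝ) / ONE / ONE) / ((j : ℝ) + 1) := div_le_div_of_nonneg_right key hpos.le
          _ = ((N : ℝ) / (((j + 1) * ONE : ℕ) : ℝ)) / ONE := by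
              have hO : (ONE : ℝ) ≠ 0 := ONE_facts.2.1
              push_cast; field_simp
          _ ≤ (cdiv N ((j + 1) * ONE) : ℝ) / ONE := div_le_div_of_nonneg_right hc ONE_facts.1.le

/-- **The uniform tail bound: `ẽ_i ≤ η/ONE` for all `i > JJ − KK` (when `JJ < d`).** -/
theorem et_le_eta (d : ℕ) (hyp : ypOf (xU d) < ONE)
    (hB : BKof (btListx d (xU d)) + Tof d (xU d) ≤ 3 * ONE)
    (hBK : BKof (btListx d (xU d)) < (JJ + 1) * ONE) (hJ : JJ < d) :
    ∀ i, JJ - KK < i → et d i ≤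
      (etaOf (etTab (btListx d (xU d)) (Tof d (xU d)) (Jd d)) (Tof d (xU d)) (BKof (btListx d (xU d))) : ℝ) / ONE := by
  have hJd : Jd d = JJ := by unfold Jd; exact min_eq_right hJ.le
  rw [hJd]
  -- concrete facts
  have hle1 := et_le_one d (sumB_le_three d hyp hB)
  have hetU := et_le_etU d hyp hB
  have hS1 : ∀ n, ∑ i ∈ range n, (if 2 ≤ i ∧ i < KK then bt d (i + 1) else 0)
      ≤ (BKof (btListx d (xU d)) : ℝ) / ONE := sumBK_le d
  have hS2 : ∀ n, ∑ i ∈ range n, (if KK ≤ i then bt d (i + 1) else 0) ≤ (Tof d (xU d) : ℝ) / ONE :=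
    fun n => sumTail_le d n hyp
  clear hyp hB
  -- make the computational atoms opaque
  generalize btListx d (xU d) = bts at *
  generalize Tof d (xU d) = T at *
  generalize BKof bts = BK at *
  generalize heta : etaOf (etTab bts T JJ) T BK = eta
  -- (a) computed indices
  have hA : ∀ i, JJ - KK < i → i ≤ JJ → (etU bts T i : ℝ) ≤ eta := by
    intro i h1 h2
    have hmem : (etTab bts T JJ).getD (JJ - i) 0 ∈ (etTab bts T JJ).take KK :=
      getD_mem_take (by unfold JJ KK at *; omega) (by rw [etTab_length]; omega)
    rw [etTab_getD bts T JJ (JJ - i) (by omega), show JJ - (JJ - i) = i by omega] at hmem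
    have le_lmax : ∀ {l : List ℕ} {a : ℕ}, a ∈ l → a ≤ lmax l := by
      intro l
      induction l with
      | nil => intro a h; simp at h
      | cons b l ih =>
        intro a h
        simp only [lmax, List.foldr_cons]
        rcases List.mem_cons.mp h with rfl | h'
        · exact le_max_left _ _
        · exact (ih h').trans (le_max_right _ _)
    have := le_lmax hmem
    have : etU bts T i ≤ eta := by rw [← heta]; exact this.trans (le_max_left _ _)
    exact_mod_cast this
  -- (b) the algebraic condition `T·ONE ≤ η·((JJ+1)·ONE − BK)`
  have hcond : (T : ℝ) * ONE ≤ (eta : ℝ) * (((JJ : ℝ) + 1) * ONE - (BK : ℝ)) := by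
    have hpos : 0 < (JJ + 1) * ONE - BK := Nat.sub_pos_of_lt hBK
    have h1 := le_cdiv_mul (T * ONE) ((JJ + 1) * ONE - BK) hpos
    have h2 : cdiv (T * ONE) ((JJ + 1) * ONE - BK) ≤ eta := by rw [← heta]; exact le_max_right _ _
    have h3 : T * ONE ≤ eta * ((JJ + 1) * ONE - BK) := h1.trans (Nat.mul_le_mul_right _ h2)
    have h4 : ((T * ONE : ℕ) : ℝ) ≤ ((eta * ((JJ + 1) * ONE - BK) : ℕ) : ℝ) := by exact_mod_cast h3
    rw [Nat.cast_mul eta, Nat.cast_sub hBK.le] at h4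
    push_cast at h4
    exact h4
  clear hBK heta
  intro i
  induction i using Nat.strong_induction_on with
  | _ i ih =>
    intro hi
    by_cases hiJ : i ≤ JJ
    · exact (hetU i).trans (div_le_div_of_nonneg_right (hA i hi hiJ) ONE_facts.1.le)
    · -- i = j + 1 > JJ
      obtain ⟨j, rfl⟩ : ∃ j, i = j + 1 := ⟨i - 1, by omega⟩
      rw [et_succ]
      have hpos : (0 : ℝ) < (j : ℝ) + 1 := by positivity
      have hterm : ∀ i' ∈ range (j + 1), (if 2 ≤ i' then bt d (i' + 1) * et d (j - i') else 0)
          ≤ (if 2 ≤ i' ∧ i' < KK then bt d (i' + 1) else 0) * ((eta : ℝ) / ONE)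
            + (if KK ≤ i' then bt d (i' + 1) else 0) := by
        intro i' hi'
        rw [Finset.mem_range] at hi'
        by_cases h2 : 2 ≤ i'
        · rw [if_pos h2]
          by_cases hK : i' < KK
          · have hnK : ¬ KK ≤ i' := by omega
            rw [if_pos ⟨h2, hK⟩, if_neg hnK, add_zero]
            have := ih (j - i') (by omega) (by have := KKJJ_val; omega)
            exact mul_le_mul_of_nonneg_left this ((bt_nonneg d _).1)
          · have hKle : KK ≤ i' := by omega
            have hn : ¬ (2 ≤ i' ∧ i' < KK) := fun h => hK h.2
            rw [if_neg hn, if_pos hKle, zero_mul, zero_add]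
            have := hle1 (j - i')
            have hb := (bt_nonneg d (i' + 1)).1
            calc bt d (i' + 1) * et d (j - i') ≤ bt d (i' + 1) * 1 := mul_le_mul_of_nonneg_left this hb
              _ = bt d (i' + 1) := mul_one _
        · have hn : ¬ (2 ≤ i' ∧ i' < KK) := fun h => h2 h.1
          have hnK : ¬ KK ≤ i' := by unfold KK; omega
          rw [if_neg h2, if_neg hn, if_neg hnK]; simp
      have hsum := Finset.sum_le_sum hterm
      rw [Finset.sum_add_distrib, ← Finset.sum_mul] at hsum
      have h1 := hS1 (j + 1)
      have h2 := hS2 (j + 1)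
      have hJ1 : ((JJ : ℝ) + 1) ≤ (j : ℝ) + 1 := by
        have : JJ + 1 ≤ j + 1 := by omega
        exact_mod_cast this
      rw [div_le_iff₀ hpos]
      have heta0 : (0 : ℝ) ≤ (eta : ℝ) / ONE := fp_nonneg _
      have hS : ∑ i' ∈ range (j + 1), (if 2 ≤ i' then bt d (i' + 1) * et d (j - i') else 0)
          ≤ (BK : ℝ) / ONE * ((eta : ℝ) / ONE) + (T : ℝ) / ONE := by
        refine hsum.trans ?_
        have := mul_le_mul_of_nonneg_right h1 heta0
        linarith
      refine hS.trans ?_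
      have hO : (ONE : ℝ) ≠ 0 := ONE_facts.2.1
      have hcond' : (T : ℝ) / ONE ≤ ((eta : ℝ) / ONE) * (((JJ : ℝ) + 1) - (BK : ℝ) / ONE) := by
        have h := div_le_div_of_nonneg_right hcond (by positivity : (0 : ℝ) ≤ (ONE : ℝ) * ONE)
        have e1 : (T : ℝ) * ONE / ((ONE : ℝ) * ONE) = (T : ℝ) / ONE := by field_simp
        have e2 : (eta : ℝ) * (((JJ : ℝ) + 1) * ONE - (BK : ℝ)) / ((ONE : ℝ) * ONE)
            = ((eta : ℝ) / ONE) * (((JJ : ℝ) + 1) - (BK : ℝ) / ONE) := by field_simp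
        rw [e1, e2] at h; exact h
      have hkey : (BK : ℝ) / ONE * ((eta : ℝ) / ONE) + (T : ℝ) / ONE ≤ (eta : ℝ) / ONE * ((JJ : ℝ) + 1) := by
        calc (BK : ℝ) / ONE * ((eta : ℝ) / ONE) + (T : ℝ) / ONE
            ≤ (BK : ℝ) / ONE * ((eta : ℝ) / ONE) + ((eta : ℝ) / ONE) * (((JJ : ℝ) + 1) - (BK : ℝ) / ONE) := by
              linarith
          _ = (eta : ℝ) / ONE * ((JJ : ℝ) + 1) := by ring
      exact hkey.trans (mul_le_mul_of_nonneg_left hJ1 heta0)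

end Summit.RiemannHypothesis.RiemannHypothesis.Theorems.JensenPolynomials.CapCert
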